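import Literature.NumberTheory.GaloisRepresentations.AbsIntegersValuationSubringsMaximalIdeals
import Literature.NumberTheory.GaloisRepresentations.IntegralGaloisActionProofs
import Literature.NumberTheory.EllipticCurves.KummerUnramified
import Literature.AnabelianGeometry.AbsoluteAnabelian.NeukirchUchidaKummerSeparation
import Mathlib.RingTheory.Invariant.Profinite
import Mathlib.FieldTheory.Galois.Infinite
import HarnessLib

/-!
# Nonarchimedean primes of `F̄` versus primes of the finite subextensions `K ⊆ F̄`:
# the finite-level dictionary (one-closure model)

Topic `Literature/NumberTheory/GaloisRepresentations` (continues `IntegralGaloisAction(Proofs)`,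
`AbsIntegersValuationSubringsMaximalIdeals`).  PROOF-ONLY (theorems, no definition, no named fact).
abc-iut cell, GAP row G-L4d2g4-1, sub-DAG `plan/L4/SUBDAG-NeukirchUchida.md` row **R3 FINITE-LEVEL
DICTIONARY** (§INTERFACES v2 currency), seat abc-iut-w5-d201; classical algebraic number theory,
outside the [IUTchIII] Cor. 3.12 cone — nothing here takes a side there.

MODEL (one algebraic closure).  `F` a number field, `Ω = F̄ = AlgebraicClosure F`,
`Γ = Field.absoluteGaloisGroup F` acting on `Ω`, on the valuation subrings of `Ω`
(`ValuationSubring.pointwiseMulAction`) and on `ℤ̄ = absIntegers (𝓞 F) F`, the algebraic integers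
of `Ω`.  A NONARCHIMEDEAN PRIME of `Ω` is a valuation subring `A ≠ ⊤`; its decomposition group is
`D_A = MulAction.stabilizer Γ A`; its centre on `ℤ̄` is the maximal ideal `absIntegersCentre A`.
A number field inside `Ω` is `K : IntermediateField F Ω` with `[FiniteDimensional F K]`, with
`Γ_K = K.fixingSubgroup.comap (absoluteGaloisGroup.toAlgEquiv F).toMonoidHom ≤ Γ`.  "`A` lies over
the ideal `P` of `𝓞 K`" is spelled `∀ x : 𝓞 K, ((x : K) : Ω) ∈ A.nonunits ↔ x ∈ P` (the centre
`𝔪_A ∩ 𝓞 K`; Neukirch, *Algebraic Number Theory*, Ch. II §8, (8.1) and the discussion following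
(8.5): the valuations of a field extending a given one ↔ primes above; Ch. I §9 (9.1): transitivity
of the Galois group).

* `mem_comap_absIntegersCentre_iff`, `existsUnique_ideal_below`, `eq_comap_absIntegersCentre_of_below`
  — the prime of `𝓞 K` below `A` exists and is unique (it is `(absIntegersCentre A).comap ι_K`,
  `ι_K : 𝓞 K → ℤ̄` the tree's `EllipticCurves.ringOfIntegersToIntegralClosure`);
  `isMaximal_of_below`, `ne_bot_of_below` (for `A ≠ ⊤`); `under_eq_of_below` (it lies over the
  prime of `𝓞 F` below `A`); `exists_valuationSubring_below` — every maximal ideal of `𝓞 K` is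
  the prime below some `A ≠ ⊤` (going up along `𝓞 K → ℤ̄`, `absIntegersValuationSubring`).
* `mem_fixingSubgroup_comap_iff` (`σ ∈ Γ_K ↔ σ` fixes `K` pointwise); `below_smul_of_mem`
  (`σ ∈ Γ_K`: `σ • A` lies over the same `P`); **`exists_smul_eq_of_below`** — TRANSITIVITY: two
  nonarchimedean primes of `Ω` over the same prime of `𝓞 K` are `Γ_K`-conjugate (Mathlib's profinite
  `Algebra.IsInvariant.exists_smul_of_under_eq_of_profinite` for `Γ_K` acting on `ℤ̄` with
  `ℤ̄^{Γ_K} = 𝓞 K`, `isInvariant_absIntegers_fixingSubgroup`); **`exists_frobenius_of_below`** —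
  an arithmetic FROBENIUS `φ ∈ D_A ∩ Γ_K` at `Ω`-level: `φ • s - s ^ #(𝓞 K ⧸ P) ∈ 𝔪_A` for every
  algebraic integer `s` (the tree's `exists_isArithFrobAt_of_isInvariant_of_profinite`).

## References
* [NeukirchANT1999] J. Neukirch, *Algebraic Number Theory* (1999), Ch. I §9 (9.1)–(9.2), (9.4);
  Ch. II §8, (8.1) Extension Theorem and the discussion following (8.5) (the extensions
  `wᵢ = eᵢ⁻¹ · v_{𝔓ᵢ}` of `v_𝔭` ↔ the primes `𝔓ᵢ ∣ 𝔭`; §8 of the 1999 English edition has items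
  (8.1)–(8.5) only — earlier versions of this file cited a non-existent «(8.6)»); Ch. IV §1 (1.2).
* [NeukirchSchmidtWingberg2008] Neukirch–Schmidt–Wingberg, *Cohomology of Number Fields*, XII §1–§2
  (the use: decomposition groups of `G_K ≤ G_F` in the Neukirch–Uchida theorem).
-/

noncomputable section

open Field NumberField IsDedekindDomain
open scoped Pointwise

namespace Literature.NumberTheory.GaloisRepresentations

open Literature.AnabelianGeometry.AbsoluteAnabelian (NeukirchUchidaProof.mem_nonunits_smul_iff)

-- as in `AbsIntegersValuationSubringsMaximalIdeals`: pointwise `Γ`-actions on `ℤ̄` and its ideals are found slowly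
set_option synthInstance.maxHeartbeats 160000

variable {F : Type} [Field F] [NumberField F]

/-! ### The prime of `𝓞 K` below a nonarchimedean prime of `F̄` -/

section Below

variable (K : IntermediateField F (AlgebraicClosure F)) (A : ValuationSubring (AlgebraicClosure F))

omit [NumberField F] in
/-- The centre of `A` on `𝓞 K`, pulled back from its centre on `ℤ̄` along `ι_K : 𝓞 K → ℤ̄`, is cut out by
the non-units of `A`: `x ∈ ι_K⁻¹(𝔪_A ∩ ℤ̄) ↔ x ∈ 𝔪_A`. [cite: NeukirchANT1999, Ch. II §8 (8.1) and discussion after (8.5)] -/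
theorem mem_comap_absIntegersCentre_iff (x : 𝓞 K) :
    x ∈ (absIntegersCentre A).comap
        (EllipticCurves.ringOfIntegersToIntegralClosure (k := F) (Ω := AlgebraicClosure F) K) ↔
      ((x : K) : AlgebraicClosure F) ∈ A.nonunits := by
  rw [Ideal.mem_comap, mem_absIntegersCentre_iff]
  exact Iff.rfl

omit [NumberField F] in
/-- **The prime of `𝓞 K` below `A` is unique**: an ideal `P` of `𝓞 K` with `x ∈ P ↔ x ∈ 𝔪_A` is the
pull-back of the centre of `A` on `ℤ̄`. [cite: NeukirchANT1999, Ch. II §8 (8.1) and discussion after (8.5)] -/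
theorem eq_comap_absIntegersCentre_of_below {P : Ideal (𝓞 K)}
    (hP : ∀ x : 𝓞 K, ((x : K) : AlgebraicClosure F) ∈ A.nonunits ↔ x ∈ P) :
    P = (absIntegersCentre A).comap
      (EllipticCurves.ringOfIntegersToIntegralClosure (k := F) (Ω := AlgebraicClosure F) K) := by
  ext x
  rw [mem_comap_absIntegersCentre_iff, hP]

omit [NumberField F] in
/-- **Existence and uniqueness of the prime of `𝓞 K` below a valuation subring `A` of `F̄`.**
[cite: NeukirchANT1999, Ch. II §8 (8.1) and discussion after (8.5)] -/
theorem existsUnique_ideal_below :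
    ∃! P : Ideal (𝓞 K), ∀ x : 𝓞 K, ((x : K) : AlgebraicClosure F) ∈ A.nonunits ↔ x ∈ P := by
  refine ⟨(absIntegersCentre A).comap
      (EllipticCurves.ringOfIntegersToIntegralClosure (k := F) (Ω := AlgebraicClosure F) K),
    fun x => (mem_comap_absIntegersCentre_iff K A x).symm, fun P hP => ?_⟩
  exact eq_comap_absIntegersCentre_of_below K A hP

omit [NumberField F] in
/-- The prime of `𝓞 K` below `A` lies over the prime of `𝓞 F` below `A`: for `r ∈ 𝓞 F`,
`r ∈ P ∩ 𝓞 F ↔ r ∈ 𝔪_A`. [cite: NeukirchANT1999, Ch. II §8 (8.1) and discussion after (8.5)] -/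
theorem mem_under_of_below {P : Ideal (𝓞 K)}
    (hP : ∀ x : 𝓞 K, ((x : K) : AlgebraicClosure F) ∈ A.nonunits ↔ x ∈ P) (r : 𝓞 F) :
    r ∈ P.under (𝓞 F) ↔ algebraMap F (AlgebraicClosure F) r ∈ A.nonunits := by
  rw [Ideal.under, Ideal.mem_comap, ← hP, IsScalarTower.algebraMap_apply F K (AlgebraicClosure F)]
  rfl

variable [FiniteDimensional F K]

omit [NumberField F] [FiniteDimensional F K] in
/-- `ℤ̄` as an `𝓞 K`-algebra through `ι_K : 𝓞 K → ℤ̄` is an INTEGRAL extension, compatibly with `𝓞 F`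
(every algebraic integer is integral over `𝓞 F ⊆ 𝓞 K`). [cite: NeukirchANT1999, Ch. I §2] -/
theorem isIntegral_absIntegers_ringOfIntegers :
    letI : Algebra (𝓞 K) (absIntegers (𝓞 F) F) :=
      (EllipticCurves.ringOfIntegersToIntegralClosure (k := F) (Ω := AlgebraicClosure F) K).toAlgebra
    IsScalarTower (𝓞 F) (𝓞 K) (absIntegers (𝓞 F) F) ∧
      Algebra.IsIntegral (𝓞 K) (absIntegers (𝓞 F) F) := by
  set ι := EllipticCurves.ringOfIntegersToIntegralClosure (k := F) (Ω := AlgebraicClosure F) K with hι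
  letI : Algebra (𝓞 K) (absIntegers (𝓞 F) F) := ι.toAlgebra
  haveI : IsScalarTower (𝓞 F) (𝓞 K) (absIntegers (𝓞 F) F) :=
    IsScalarTower.of_algebraMap_eq fun r =>
      (RingHom.congr_fun (EllipticCurves.ringOfIntegersToIntegralClosure_comp_algebraMap
        (k := F) (Ω := AlgebraicClosure F) K) r).symm
  exact ⟨inferInstance, Algebra.IsIntegral.tower_top (R := 𝓞 F)⟩

omit [FiniteDimensional F K] in
/-- For a NONTRIVIAL valuation subring `A ≠ ⊤` the prime of `𝓞 K` below `A` is nonzero (its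
extension to the integral extension `ℤ̄` is the nonzero centre `𝔪_A ∩ ℤ̄`, Mathlib
`Ideal.eq_bot_of_comap_eq_bot`). [cite: NeukirchANT1999, Ch. II §8 (8.1) and discussion after (8.5)] -/
theorem ne_bot_of_below (hA : A ≠ ⊤) {P : Ideal (𝓞 K)}
    (hP : ∀ x : 𝓞 K, ((x : K) : AlgebraicClosure F) ∈ A.nonunits ↔ x ∈ P) : P ≠ ⊥ := by
  set ι := EllipticCurves.ringOfIntegersToIntegralClosure (k := F) (Ω := AlgebraicClosure F) K with hι
  letI : Algebra (𝓞 K) (absIntegers (𝓞 F) F) := ι.toAlgebra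
  haveI := (isIntegral_absIntegers_ringOfIntegers (F := F) K).2
  intro hbot
  rw [eq_comap_absIntegersCentre_of_below K A hP] at hbot
  exact absIntegersCentre_ne_bot A hA (Ideal.eq_bot_of_comap_eq_bot hbot)

/-- For `A ≠ ⊤` the prime of `𝓞 K` below `A` is MAXIMAL (a nonzero prime of the Dedekind domain
`𝓞 K`). [cite: NeukirchANT1999, Ch. II §8 (8.1) and discussion after (8.5)] -/
theorem isMaximal_of_below (hA : A ≠ ⊤) {P : Ideal (𝓞 K)}
    (hP : ∀ x : 𝓞 K, ((x : K) : AlgebraicClosure F) ∈ A.nonunits ↔ x ∈ P) : P.IsMaximal := by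
  haveI : NumberField K := NumberField.of_module_finite F K
  haveI := absIntegersCentre_isPrime A
  have hprime : P.IsPrime := by
    rw [eq_comap_absIntegersCentre_of_below K A hP]
    exact Ideal.comap_isPrime _ _
  exact hprime.isMaximal (ne_bot_of_below K A hA hP)

omit [FiniteDimensional F K] in
/-- **Every maximal ideal of `𝓞 K` is the prime below some nonarchimedean prime of `F̄`** (going up
along the integral extension `𝓞 K → ℤ̄`, then the valuation ring `ℤ̄_𝔓` of a maximal ideal `𝔓` of `ℤ̄`,
`absIntegersValuationSubring`). [cite: NeukirchANT1999, Ch. II §8 (8.1) and discussion after (8.5)] -/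
theorem exists_valuationSubring_below (P : Ideal (𝓞 K)) [P.IsMaximal] :
    ∃ A : ValuationSubring (AlgebraicClosure F), A ≠ ⊤ ∧
      ∀ x : 𝓞 K, ((x : K) : AlgebraicClosure F) ∈ A.nonunits ↔ x ∈ P := by
  set ι := EllipticCurves.ringOfIntegersToIntegralClosure (k := F) (Ω := AlgebraicClosure F) K with hι
  letI : Algebra (𝓞 K) (absIntegers (𝓞 F) F) := ι.toAlgebra
  haveI := (isIntegral_absIntegers_ringOfIntegers (F := F) K).2
  have hinj : Function.Injective (algebraMap (𝓞 K) (absIntegers (𝓞 F) F)) :=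
    EllipticCurves.ringOfIntegersToIntegralClosure_injective (k := F) (Ω := AlgebraicClosure F) K
  have hker : RingHom.ker (algebraMap (𝓞 K) (absIntegers (𝓞 F) F)) ≤ P := by
    rw [(RingHom.injective_iff_ker_eq_bot _).mp hinj]
    exact bot_le
  obtain ⟨𝔓, h𝔓max, h𝔓P⟩ := Ideal.exists_ideal_over_maximal_of_isIntegral P hker
  haveI := h𝔓max
  refine ⟨absIntegersValuationSubring 𝔓, absIntegersValuationSubring_ne_top 𝔓, fun x => ?_⟩
  rw [← mem_comap_absIntegersCentre_iff, absIntegersCentre_absIntegersValuationSubring]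
  exact Iff.of_eq (congrArg (x ∈ ·) h𝔓P)

end Below

/-! ### `Γ_K`: the automorphisms fixing `K`, their action on the primes above a prime of `K` -/

section FixingSubgroup

variable (K : IntermediateField F (AlgebraicClosure F))

omit [NumberField F] in
/-- `σ ∈ Γ_K = K.fixingSubgroup` (read in `Γ = absoluteGaloisGroup F`) iff `σ` fixes `K` pointwise (Krull's
Galois correspondence, `Γ_K = G(F̄|K)`). [cite: NeukirchANT1999, Ch. IV §1 Thm. (1.2)] -/
theorem mem_fixingSubgroup_comap_iff (σ : absoluteGaloisGroup F) :
    σ ∈ K.fixingSubgroup.comap (absoluteGaloisGroup.toAlgEquiv F).toMonoidHom ↔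
      ∀ x : AlgebraicClosure F, x ∈ K → σ • x = x := by
  rw [Subgroup.mem_comap, MulEquiv.coe_toMonoidHom, IntermediateField.mem_fixingSubgroup_iff]
  rfl

omit [NumberField F] in
/-- **`Γ_K` preserves the prime below**: if `A` lies over the ideal `P` of `𝓞 K` and `σ ∈ Γ_K`, then
`σ • A` lies over `P`. [cite: NeukirchANT1999, Ch. I §9 (9.1)] -/
theorem below_smul_of_mem {σ : absoluteGaloisGroup F}
    (hσ : σ ∈ K.fixingSubgroup.comap (absoluteGaloisGroup.toAlgEquiv F).toMonoidHom)
    {A : ValuationSubring (AlgebraicClosure F)} {P : Ideal (𝓞 K)}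
    (hP : ∀ x : 𝓞 K, ((x : K) : AlgebraicClosure F) ∈ A.nonunits ↔ x ∈ P) (x : 𝓞 K) :
    ((x : K) : AlgebraicClosure F) ∈ (σ • A).nonunits ↔ x ∈ P := by
  rw [NeukirchUchidaProof.mem_nonunits_smul_iff, ← hP]
  have hfix : σ⁻¹ • ((x : K) : AlgebraicClosure F) = ((x : K) : AlgebraicClosure F) :=
    (mem_fixingSubgroup_comap_iff K σ⁻¹).mp (Subgroup.inv_mem _ hσ) _ (x : K).2
  rw [hfix]

variable [FiniteDimensional F K]

omit [FiniteDimensional F K] in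
/-- **`ℤ̄^{Γ_K} = 𝓞 K` and the profinite set-up.**  For the closed subgroup `Γ_K ≤ Γ` acting on the algebraic
integers `ℤ̄` (an `𝓞 K`-algebra through `ι_K`): the actions of `Γ_K` and `𝓞 K` commute, and an algebraic
integer fixed by `Γ_K` comes from `𝓞 K` (Krull: `F̄^{Γ_K} = K`, Mathlib `InfiniteGalois.fixedField_fixingSubgroup`;
integrality descends). [cite: NeukirchANT1999, Ch. I §9 (9.1)] -/
theorem isInvariant_absIntegers_fixingSubgroup :
    letI : Algebra (𝓞 K) (absIntegers (𝓞 F) F) :=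
      (EllipticCurves.ringOfIntegersToIntegralClosure (k := F) (Ω := AlgebraicClosure F) K).toAlgebra
    SMulCommClass ↥(K.fixingSubgroup.comap (absoluteGaloisGroup.toAlgEquiv F).toMonoidHom) (𝓞 K)
        (absIntegers (𝓞 F) F) ∧
      Algebra.IsInvariant (𝓞 K) (absIntegers (𝓞 F) F)
        ↥(K.fixingSubgroup.comap (absoluteGaloisGroup.toAlgEquiv F).toMonoidHom) := by
  set ι := EllipticCurves.ringOfIntegersToIntegralClosure (k := F) (Ω := AlgebraicClosure F) K with hι
  set Γ_K := K.fixingSubgroup.comap (absoluteGaloisGroup.toAlgEquiv F).toMonoidHom with hΓK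
  letI : Algebra (𝓞 K) (absIntegers (𝓞 F) F) := ι.toAlgebra
  have hfixι : ∀ (σ : Γ_K) (x : 𝓞 K),
      σ • algebraMap (𝓞 K) (absIntegers (𝓞 F) F) x = algebraMap (𝓞 K) (absIntegers (𝓞 F) F) x :=
    fun σ x => by
    apply Subtype.ext
    change (σ : absoluteGaloisGroup F) • ((x : K) : AlgebraicClosure F) = ((x : K) : AlgebraicClosure F)
    exact (mem_fixingSubgroup_comap_iff K _).mp σ.2 _ (x : K).2
  refine ⟨⟨fun σ x b => ?_⟩, ⟨fun b hb => ?_⟩⟩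
  · rw [Algebra.smul_def, Algebra.smul_def, smul_mul', hfixι]
  · -- `b` is fixed by `Γ_K`, hence lies in `K`; it is integral, hence in `𝓞 K`
    have hbK : (b : AlgebraicClosure F) ∈ K := by
      rw [← InfiniteGalois.fixedField_fixingSubgroup K, IntermediateField.mem_fixedField_iff]
      intro f hf
      have h1 := hb ⟨(absoluteGaloisGroup.toAlgEquiv F).symm f, by
        rw [hΓK, Subgroup.mem_comap]; simpa using hf⟩
      have h2 := congrArg Subtype.val h1
      rw [Subgroup.smul_def, integralClosure.coe_smul] at h2
      exact h2
    have hint : IsIntegral ℤ (⟨(b : AlgebraicClosure F), hbK⟩ : K) := by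
      have hb' : IsIntegral ℤ (b : AlgebraicClosure F) := isIntegral_trans (R := ℤ) _ b.2
      exact (isIntegral_algHom_iff (IsScalarTower.toAlgHom ℤ K (AlgebraicClosure F))
        (algebraMap K (AlgebraicClosure F)).injective).mp hb'
    refine ⟨⟨⟨(b : AlgebraicClosure F), hbK⟩, hint⟩, Subtype.ext ?_⟩
    rfl

omit [FiniteDimensional F K] in
/-- **Transitivity**: two valuation subrings of `F̄` (`B ≠ ⊤`) over the same prime of `𝓞 K` are conjugate
under `Γ_K` (Neukirch Ch. I (9.1) at finite level, Ch. II §8 after (8.5) / §9 (9.1); here for the profinite `Γ_K` acting on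
`ℤ̄`, Mathlib `Algebra.IsInvariant.exists_smul_of_under_eq_of_profinite`, then valuation rings ↔ their
centres, `eq_absIntegersValuationSubring_of_absIntegersCentre_eq`). [cite: NeukirchANT1999, Ch. I §9 (9.1)] -/
theorem exists_smul_eq_of_below {A B : ValuationSubring (AlgebraicClosure F)} (hB : B ≠ ⊤)
    {P : Ideal (𝓞 K)} (hPA : ∀ x : 𝓞 K, ((x : K) : AlgebraicClosure F) ∈ A.nonunits ↔ x ∈ P)
    (hPB : ∀ x : 𝓞 K, ((x : K) : AlgebraicClosure F) ∈ B.nonunits ↔ x ∈ P) :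
    ∃ σ ∈ K.fixingSubgroup.comap (absoluteGaloisGroup.toAlgEquiv F).toMonoidHom, σ • A = B := by
  classical
  set ι := EllipticCurves.ringOfIntegersToIntegralClosure (k := F) (Ω := AlgebraicClosure F) K with hι
  set Γ_K := K.fixingSubgroup.comap (absoluteGaloisGroup.toAlgEquiv F).toMonoidHom with hΓK
  letI : Algebra (𝓞 K) (absIntegers (𝓞 F) F) := ι.toAlgebra
  obtain ⟨hcomm, hinv⟩ := isInvariant_absIntegers_fixingSubgroup (F := F) K
  haveI := hcomm
  haveI := hinv
  -- the profinite set-up: `Γ_K` is closed in the compact `Γ`, `ℤ̄` is discrete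
  have hclosed : IsClosed (Γ_K : Set (absoluteGaloisGroup F)) := InfiniteGalois.fixingSubgroup_isClosed K
  haveI : CompactSpace Γ_K := isCompact_iff_compactSpace.mp hclosed.isCompact
  letI : TopologicalSpace (absIntegers (𝓞 F) F) := ⊥
  haveI : DiscreteTopology (absIntegers (𝓞 F) F) := ⟨rfl⟩
  haveI := absIntegers.continuousSMul (𝓞 F) (K := F)
  haveI := absIntegersCentre_isPrime A
  haveI := absIntegersCentre_isPrime B
  have hunder : (absIntegersCentre A).under (𝓞 K) = (absIntegersCentre B).under (𝓞 K) := by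
    change (absIntegersCentre A).comap ι = (absIntegersCentre B).comap ι
    rw [← eq_comap_absIntegersCentre_of_below K A hPA, ← eq_comap_absIntegersCentre_of_below K B hPB]
  obtain ⟨g, hg⟩ := Algebra.IsInvariant.exists_smul_of_under_eq_of_profinite (A := 𝓞 K)
    (B := absIntegers (𝓞 F) F) (G := Γ_K) (absIntegersCentre A) (absIntegersCentre B) hunder
  -- read the conjugating element in `Γ`, and pass from centres to valuation rings
  have hg' : absIntegersCentre ((g : absoluteGaloisGroup F) • A) = absIntegersCentre B := by
    rw [absIntegersCentre_smul, hg]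
    rfl
  refine ⟨(g : absoluteGaloisGroup F), g.2, ?_⟩
  haveI := absIntegersCentre_isMaximal B hB
  rw [eq_absIntegersValuationSubring_of_absIntegersCentre_eq _ (absIntegersCentre B) hg',
    ← eq_absIntegersValuationSubring_of_absIntegersCentre_eq B (absIntegersCentre B) rfl]

omit [FiniteDimensional F K] in
/-- **Fibres are orbits**: `B ≠ ⊤` lies over the prime of `𝓞 K` below `A` iff `B ∈ Γ_K • A`.
[cite: NeukirchANT1999, Ch. I §9 (9.1)] -/
theorem below_iff_exists_smul_eq {A B : ValuationSubring (AlgebraicClosure F)} (hB : B ≠ ⊤)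
    {P : Ideal (𝓞 K)} (hPA : ∀ x : 𝓞 K, ((x : K) : AlgebraicClosure F) ∈ A.nonunits ↔ x ∈ P) :
    (∀ x : 𝓞 K, ((x : K) : AlgebraicClosure F) ∈ B.nonunits ↔ x ∈ P) ↔
      ∃ σ ∈ K.fixingSubgroup.comap (absoluteGaloisGroup.toAlgEquiv F).toMonoidHom, σ • A = B := by
  constructor
  · exact exists_smul_eq_of_below K hB hPA
  · rintro ⟨σ, hσ, rfl⟩
    exact below_smul_of_mem K hσ hPA

/-- **Arithmetic Frobenius at `Ω`-level.**  If the nontrivial valuation subring `A` of `F̄` lies over the prime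
`P` of `𝓞 K`, some `φ ∈ D_A ∩ Γ_K` satisfies `φ • s ≡ s ^ #(𝓞 K ⧸ P) (mod 𝔪_A)` for every algebraic integer
`s` of `F̄` (Frobenius elements for the profinite `Γ_K` acting on `ℤ̄`, the tree's
`exists_isArithFrobAt_of_isInvariant_of_profinite`; the Frobenius stabilises the centre of `A`, hence `A`).
[cite: NeukirchANT1999, Ch. I §9 Prop. (9.4)] -/
theorem exists_frobenius_of_below {A : ValuationSubring (AlgebraicClosure F)} (hA : A ≠ ⊤)
    {P : Ideal (𝓞 K)} (hPA : ∀ x : 𝓞 K, ((x : K) : AlgebraicClosure F) ∈ A.nonunits ↔ x ∈ P) :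
    ∃ φ ∈ MulAction.stabilizer (absoluteGaloisGroup F) A ⊓
        K.fixingSubgroup.comap (absoluteGaloisGroup.toAlgEquiv F).toMonoidHom,
      ∀ s : AlgebraicClosure F, IsIntegral ℤ s →
        φ • s - s ^ Nat.card (𝓞 K ⧸ P) ∈ A.nonunits := by
  classical
  haveI : NumberField K := NumberField.of_module_finite F K
  set ι := EllipticCurves.ringOfIntegersToIntegralClosure (k := F) (Ω := AlgebraicClosure F) K with hι
  set Γ_K := K.fixingSubgroup.comap (absoluteGaloisGroup.toAlgEquiv F).toMonoidHom with hΓK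
  letI : Algebra (𝓞 K) (absIntegers (𝓞 F) F) := ι.toAlgebra
  obtain ⟨hcomm, hinv⟩ := isInvariant_absIntegers_fixingSubgroup (F := F) K
  haveI := hcomm
  haveI := hinv
  have hclosed : IsClosed (Γ_K : Set (absoluteGaloisGroup F)) := InfiniteGalois.fixingSubgroup_isClosed K
  haveI : CompactSpace Γ_K := isCompact_iff_compactSpace.mp hclosed.isCompact
  letI : TopologicalSpace (absIntegers (𝓞 F) F) := ⊥
  haveI : DiscreteTopology (absIntegers (𝓞 F) F) := ⟨rfl⟩
  haveI := absIntegers.continuousSMul (𝓞 F) (K := F)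
  haveI := absIntegersCentre_isMaximal A hA
  have hunder : (absIntegersCentre A).under (𝓞 K) = P :=
    (eq_comap_absIntegersCentre_of_below K A hPA).symm
  haveI : P.IsMaximal := isMaximal_of_below K A hA hPA
  haveI : Finite (𝓞 K ⧸ (absIntegersCentre A).under (𝓞 K)) := by
    rw [hunder]
    exact Ideal.finiteQuotientOfFreeOfNeBot P (ne_bot_of_below K A hA hPA)
  obtain ⟨σ, hσ⟩ := exists_isArithFrobAt_of_isInvariant_of_profinite (A := 𝓞 K)
    (B := absIntegers (𝓞 F) F) (G := Γ_K) (absIntegersCentre A)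
  have hstab : (σ : absoluteGaloisGroup F) ∈ MulAction.stabilizer (absoluteGaloisGroup F) A := by
    rw [stabilizer_eq_stabilizer_absIntegersCentre A hA, MulAction.mem_stabilizer_iff]
    have h := hσ.mem_stabilizer
    rw [MulAction.mem_stabilizer_iff] at h
    exact h
  refine ⟨(σ : absoluteGaloisGroup F), ⟨hstab, σ.2⟩, fun s hs => ?_⟩
  have hsF : s ∈ absIntegers (𝓞 F) F := by
    rw [mem_integralClosure_iff]
    exact hs.tower_top
  have h1 := hσ ⟨s, hsF⟩
  rw [MulSemiringAction.toAlgHom_apply, hunder] at h1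
  have h2 := (mem_absIntegersCentre_iff A _).mp h1
  have hcoe : (((σ • (⟨s, hsF⟩ : absIntegers (𝓞 F) F) - ⟨s, hsF⟩ ^ Nat.card (𝓞 K ⧸ P) :
      absIntegers (𝓞 F) F)) : AlgebraicClosure F) =
      (σ : absoluteGaloisGroup F) • s - s ^ Nat.card (𝓞 K ⧸ P) := rfl
  rw [hcoe] at h2
  exact h2

/-- The prime `P` of `𝓞 K` below `A` lies over the prime `v` of `𝓞 F` below `A`. [cite: NeukirchANT1999, Ch. II §8 (8.1) and discussion after (8.5)] -/
theorem mem_primesOver_of_below {A : ValuationSubring (AlgebraicClosure F)} (hA : A ≠ ⊤)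
    {P : Ideal (𝓞 K)} (hPA : ∀ x : 𝓞 K, ((x : K) : AlgebraicClosure F) ∈ A.nonunits ↔ x ∈ P)
    {v : HeightOneSpectrum (𝓞 F)}
    (hv : ∀ r : 𝓞 F, algebraMap F (AlgebraicClosure F) r ∈ A.nonunits ↔ r ∈ v.asIdeal) :
    P ∈ v.asIdeal.primesOver (𝓞 K) := by
  refine ⟨(isMaximal_of_below K A hA hPA).isPrime, ⟨?_⟩⟩
  ext r
  rw [← hv r, mem_under_of_below K A hPA r]

end FixingSubgroup

/-! ### Towers `K ≤ L ⊆ F̄`: the prime below `A` in `L` lies over the prime below `A` in `K` -/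

section Tower

omit [NumberField F] in
/-- **Tower compatibility of the primes below `A`** (§INTERFACES R3.3): for number fields `K ≤ L` inside
`F̄` (with `L` an algebra over `K` through the inclusion), if `A` lies over `Q ⊆ 𝓞 L` and over `P ⊆ 𝓞 K`,
then `Q` lies over `P` — `Q ∈ P.primesOver (𝓞 L)` (Neukirch Ch. II §8, discussion after (8.5): restriction of valuations
along `K ⊆ L ⊆ F̄`). [cite: NeukirchANT1999, Ch. II §8 (8.1) and discussion after (8.5)] -/
theorem mem_primesOver_of_below_of_le {K L : IntermediateField F (AlgebraicClosure F)} (hKL : K ≤ L)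
    {A : ValuationSubring (AlgebraicClosure F)} {P : Ideal (𝓞 K)} {Q : Ideal (𝓞 L)}
    (hP : ∀ x : 𝓞 K, ((x : K) : AlgebraicClosure F) ∈ A.nonunits ↔ x ∈ P)
    (hQ : ∀ y : 𝓞 L, ((y : L) : AlgebraicClosure F) ∈ A.nonunits ↔ y ∈ Q) :
    letI : Algebra K L := (IntermediateField.inclusion hKL).toRingHom.toAlgebra
    Q ∈ P.primesOver (𝓞 L) := by
  letI : Algebra K L := (IntermediateField.inclusion hKL).toRingHom.toAlgebra
  haveI := absIntegersCentre_isPrime A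
  have hQprime : Q.IsPrime := by
    rw [eq_comap_absIntegersCentre_of_below L A hQ]
    exact Ideal.comap_isPrime _ _
  refine ⟨hQprime, ⟨?_⟩⟩
  ext x
  rw [Ideal.under, Ideal.mem_comap, ← hQ, ← hP]
  exact Iff.rfl

end Tower

end Literature.NumberTheory.GaloisRepresentations

end
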